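import Summits.RiemannHypothesis.RiemannHypothesis.Theorems.GroundBartaPolarPerronFrobeniusEvenRealGroundState
import Literature.NumberTheory.LFunctions.WeilGroundEnergyParitySplit
import Literature.NumberTheory.LFunctions.WeilGroundEnergyProofs
import HarnessLib

/-!
# Crux `GroundBarta.PolarPerronFrobenius` (stmt-RiemannHypothesis-18390), line `Sketch`
# (cone–compactness): stub S2 `stub_coneDense_of_even` (RH-free parity funnel)

At a genuine window `a > 0` where the even sector carries the bottom (`EW a`: every odd normalised
window test is matched up to any `δ > 0` by an even one) and EVEN cone tests are energy-dense among
EVEN normalised window tests, cone tests (pointwise real, `≥ 0`, normalised — no parity asked) are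
dense among ALL normalised window tests.  Proof: `EW a` gives `ε_ev(a) ≤ ε_od(a)`
(`weilEvenGroundEnergy_le_weilOddGroundEnergy_of_evenWinsAt`, in tree), so by the parity split
`ε(a) = min (ε_ev(a), ε_od(a)) = ε_ev(a)` (`weilGroundEnergy_eq_min_even_odd`); an even normalised
test `δ/2`-close to `ε_ev(a)` exists (the even sphere is nonempty and bounded below), and an even cone
test `δ/2`-close to it is `δ`-close to `ε(a) ≤ Re Q(h)` for every normalised window test `h`.
Mathlib + proved tree files only; no named fact.
-/

set_option linter.dupNamespace false

noncomputable section

open Set MeasureTheory Filter Complex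
open scoped Topology

namespace Summit.RiemannHypothesis.RiemannHypothesis.Theorems.PolarPerronFrobenius

open Literature.NumberTheory.LFunctions

/-- **Stub S2 of line `Sketch` (cone–compactness) — the parity funnel.**  At a window `a > 0`
where the even sector carries the bottom and even cone tests are dense among even tests, cone tests
are dense among all normalised window tests. -/
theorem stub_coneDense_of_even :
    ∀ a : ℝ, 0 < a →
      (∀ o : ℝ → ℂ, Literature.NumberTheory.LFunctions.IsWeilTest o → tsupport o ⊆ Set.Icc (-a) a →
            (∀ t, o (-t) = -o t) → ∫ t, ‖o t‖ ^ 2 = (1 : ℝ) → ∀ δ : ℝ, 0 < δ →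
              ∃ w : ℝ → ℂ, Literature.NumberTheory.LFunctions.IsWeilTest w ∧
                tsupport w ⊆ Set.Icc (-a) a ∧ (∀ t, w (-t) = w t) ∧ ∫ t, ‖w t‖ ^ 2 = (1 : ℝ) ∧
                (Literature.NumberTheory.LFunctions.weilQuadratic w).re ≤
                  (Literature.NumberTheory.LFunctions.weilQuadratic o).re + δ) →
      (∀ h : ℝ → ℂ, Literature.NumberTheory.LFunctions.IsWeilTest h → tsupport h ⊆ Set.Icc (-a) a →
            (∀ t, h (-t) = h t) → ∫ t, ‖h t‖ ^ 2 = (1 : ℝ) → ∀ δ : ℝ, 0 < δ →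
              ∃ w : ℝ → ℂ, Literature.NumberTheory.LFunctions.IsWeilTest w ∧
                tsupport w ⊆ Set.Icc (-a) a ∧ (∀ t, w (-t) = w t) ∧
                (∀ t, (w t).im = 0 ∧ 0 ≤ (w t).re) ∧ ∫ t, ‖w t‖ ^ 2 = (1 : ℝ) ∧
                (Literature.NumberTheory.LFunctions.weilQuadratic w).re ≤
                  (Literature.NumberTheory.LFunctions.weilQuadratic h).re + δ) →
      ∀ h : ℝ → ℂ, Literature.NumberTheory.LFunctions.IsWeilTest h → tsupport h ⊆ Set.Icc (-a) a →
          ∫ t, ‖h t‖ ^ 2 = (1 : ℝ) → ∀ δ : ℝ, 0 < δ →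
            ∃ w : ℝ → ℂ, Literature.NumberTheory.LFunctions.IsWeilTest w ∧
              tsupport w ⊆ Set.Icc (-a) a ∧ (∀ t, (w t).im = 0 ∧ 0 ≤ (w t).re) ∧
              ∫ t, ‖w t‖ ^ 2 = (1 : ℝ) ∧
              (Literature.NumberTheory.LFunctions.weilQuadratic w).re ≤
                (Literature.NumberTheory.LFunctions.weilQuadratic h).re + δ := by
  intro a ha hEW hEven h hh hs hn δ hδ
  -- the even sector carries the bottom: `ε(a) = ε_ev(a)`
  have hle : weilEvenGroundEnergy a ≤ weilOddGroundEnergy a :=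
    weilEvenGroundEnergy_le_weilOddGroundEnergy_of_evenWinsAt ha hEW
  have hε : weilGroundEnergy a = weilEvenGroundEnergy a := by
    rw [weilGroundEnergy_eq_min_even_odd, min_eq_left hle]
  have hεh : weilGroundEnergy a ≤ (weilQuadratic h).re :=
    csInf_le (bddBelow_weilQuadratic_sphere_holds a) ⟨h, hh, hs, hn, rfl⟩
  -- an even normalised test `δ/2`-close to `ε_ev(a)`
  have hne := weilWindowSphereValues_even_nonempty ha
  have hδ2 : 0 < δ / 2 := by positivity
  have hlt : sInf (weilWindowSphereValues (fun g ↦ ∀ t, g (-t) = g t) a) <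
      weilEvenGroundEnergy a + δ / 2 := by
    rw [← weilEvenGroundEnergy_eq_sInf]; linarith
  obtain ⟨y, ⟨e, he, hes, heven, hen, rfl⟩, hy⟩ := exists_lt_of_csInf_lt hne hlt
  -- an even cone test `δ/2`-close to it
  obtain ⟨w, hw, hws, -, hwsign, hwn, hwle⟩ := hEven e he hes heven hen (δ / 2) hδ2
  refine ⟨w, hw, hws, hwsign, hwn, ?_⟩
  linarith

end Summit.RiemannHypothesis.RiemannHypothesis.Theorems.PolarPerronFrobenius

end
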